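/-
Copyright (c) 2026 the pub-hodgecm-mathlib formalisation cell (harness21).  Prover seat hodgecm-mathlib-K2E4-p23 (g0) (E4 base on loan to ENGINE E1), Track B ∕ K2-LIT,
h413 = `stmt-HodgeConjecture-24833`, campaign «EIS-WHITTAKER-3» (`U(2,1)`, CM `L ∕ L⁺`), brick «W3-ENGINE-ℂ» (dealer K2E1-plan (g5) 2026-09-04T08:27:09Z DEAL (3)):
THE COMPLEX TWIN OF THE W3-ENGINE'S ARCHIMEDEAN SPLITTING — over a totally complex `K` the archimedean Whittaker factor is a product over the complex places of the
one-variable transforms `∫_ℂ φ_w(X)·e^{−4πi Re(ξ_w X)} dX`, and `vol(D_∞) = 2^{−d}·√|d_L|` for `L` CM.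
-/
import Summits.HodgeConjecture.HodgeConjecture.Theorems.K2E1AdelicFourierCoeffEulerProduct     -- ★ W3-engine (generic K): §1 split `adeleFourierCoeff_map_split_eq_mul`, `measure_map_split_adeleFundamentalDomain`; §3 real twin :242
import Summits.HodgeConjecture.HodgeConjecture.Theorems.K2E1ArchWhittakerContinuationU3       -- ★ p858580 (this seat, D-W2 FILE A): `integral_integral_archSymbolU3_mul_phase_eq` (the complex-place factor in closed form)
import Mathlib.NumberTheory.NumberField.CMField                                               -- `IsCMField` (`⇒ IsTotallyComplex`, quadratic over `maximalRealSubfield`)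
import HarnessLib

/-!
# K2·E1 — `K2E1AdelicFourierCoeffEulerProductCM` («EIS-WHITTAKER-3», brick «W3-ENGINE-ℂ»): the archimedean splitting of the adelic Fourier coefficient over a TOTALLY COMPLEX ∕ CM field

Track B ∕ K2-LIT, crux h413 = `stmt-HodgeConjecture-24833`, route of record `HCCMUnconditional`; cell `hodgecm-mathlib`, squad K2, ENGINE E1, campaign «EIS-WHITTAKER-3»
(dealer K2E1-plan (g5) DEAL (3) 08:27:09Z; CONVENTIONS memo W0₃ 2fdd2f7063acaab9 §1 (W), RULING «LETTERS-μD»).  Prover seat `hodgecm-mathlib-K2E4-p23` (g0).  THEOREMS ONLY (no `def`,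
no `instance`, no notation, no named-fact hypothesis, no `sorry`); lane `--supports stmt-HodgeConjecture-24833 --as helper` (count-neutral).  Closes no socket.  Consumer: W3₃ FILE B
`K2E1WhittakerCoefficientEulerProductU3…` (K2E4-p10 (g5)) — the `hsplit : Λ = c·A·I` input with `A = W_∞(ξ,z)` an honest product over the complex places of `L`.

THE MATHEMATICS [TateThesis1967 §4.1; Bump1997 §1.6, §3.7; Garrett2018 §1.9–§1.10].  ★ W3-engine §1–§2 are stated for a GENERIC number field and apply at `K = L` verbatim
(`Φ̂(ξ) = (∫_{mixedSpace L} Φ_∞(s)·𝐞(−Tr(ξs)) dμ_E)·(∫ Φ_f ψ_f(ξ·) dμ_f)`, `μ(D) = μ_E(D_∞)·μ_f(𝒪̂)`); its §3 splits the archimedean integral over the REAL places of a totally real field.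
Here is the twin for a TOTALLY COMPLEX `K` (every CM field): `mixedSpace K = (∅ → ℝ) × ({w complex} → ℂ)`, Tate's trace form is `Tr(x) = Σ_w 2 Re(x_w)` (★ `mixedTrace_apply`), so his
kernel at a complex place is `𝐞(−2 Re(ξ_w X)) = e^{−4πi Re(ξ_w X)}` — the letter of ★ p858580 — and for a pure tensor `Φ_∞(s) = ∏_w φ_w(s_w)`, with Lebesgue `volume` on `mixedSpace K`
(the product of the Lebesgue measures `dX = dx dy` on the factors `ℂ`):
* §1 (`K` totally complex) `coe_fourierChar_neg_sum_two_mul_re`, `mixedTrace_mixedEmbedding_mul_of_isTotallyComplex`, **`integral_prod_mul_fourierChar_eq_prod_of_isTotallyComplex`**: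
  `∫ (∏_w φ_w(s_w))·𝐞(−Tr(ξs)) ds = ∏_w ∫_ℂ φ_w(X)·e^{−4πi Re(ξ_w X)} dX` (`ξ_w = (mixedEmbedding K ξ).2 w = w.embedding ξ`; Mathlib `integral_fun_snd` discards the trivial real factor,
  `integral_fintype_prod_volume_eq_prod`), its re-indexed form `…_of_equiv` and the form `…_infinitePlace` indexed by ALL infinite places (all complex; `Equiv.subtypeUnivEquiv`);
  **`adeleFourierCoeff_map_split_eq_prod_mul_of_isTotallyComplex`**: ★ §1 at `μ_E := volume`, `Φ_∞ = ∏_w φ_w` — `Φ̂(ξ) = (∏_w ∫_ℂ φ_w·e^{−4πi Re(ξ_w ·)}) · ∫ Φ_f·ψ_f(ξ·) dμ_f`;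
  `volume_fundamentalDomain_latticeBasis_of_isTotallyComplex`: `vol(D_∞) = 2^{−[K:ℚ]∕2}·√|d_K|` (Mathlib `volume_fundamentalDomain_latticeBasis`, `[K:ℚ] = 2r₂`).
* §2 (`L` CM) `nrComplexPlaces_eq_finrank_maximalRealSubfield` (`r₂(L) = [L⁺:ℚ] =: d`), **`volume_fundamentalDomain_latticeBasis_cm`**: `vol(D_∞(L)) = 2^{−d}·√|d_L|`, and the ONE evaluation
  corollary of the `μ_E(D_E)` letter (RULING «LETTERS-μD»; CONVENTIONS §1 (W)): **`measure_map_split_adeleFundamentalDomain_cm`**: `μ(D_L) = 2^{−d}·√|d_L|·μ_f(𝒪̂_L)` for `μ = σ_*(vol ⊗ μ_f)`.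
* §3 RIDER in the D-W2 letters (★ p858580): **`integral_prod_archCentre_mul_fourierChar_eq_prod`** — for the centre-averaged big-cell symbol `φ_w(X) = ∫_ℝ ((1 + ½|X|²)² + |δ|_w² t²)^{−z} dt` and
  `Re z > 1`, `∫ (∏_w φ_w(s_w))·𝐞(−Tr(ξs)) ds = ∏_w 2π²·4^{1−z}·|δ|_w⁻¹·Γ(z)⁻²·𝓜[e^{−t−8π²|ξ_w|²∕t}](2z−2)` — the Whittaker layer's `W_∞(ξ,z)` at `g = k` in CLOSED FORM by name.
HONEST LABEL: HC_CM is proved only modulo the 7 printed citations (2 remaining named inputs: hLiu418 = `stmt-HodgeConjecture-24832`, h413 = `stmt-HodgeConjecture-24833`)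
until rung 0 closes; this file asserts no named fact and closes no socket.
References: [TateThesis1967] J. Tate, *Fourier analysis in number fields and Hecke's zeta-functions* (Cassels–Fröhlich 1967), §4.1 Lemma 4.1.4 · [Bump1997] D. Bump, *Automorphic Forms and
Representations* (1997), §1.6 (1.26), §3.7 · [Garrett2018] P. Garrett, *Modern Analysis of Automorphic Forms by Example* 1 (2018), §1.9–§1.10.
-/

set_option autoImplicit false
set_option linter.dupNamespace false -- the mandated namespace repeats `HodgeConjecture.HodgeConjecture`

noncomputable section

open MeasureTheory Measure NumberField NumberField.InfinitePlace NumberField.mixedEmbedding IsDedekindDomain Set Filter Topology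
open scoped ENNReal NNReal Real FourierTransform Classical
open Literature.NumberTheory.Automorphic
open Summit.HodgeConjecture.HodgeConjecture.Cruxes.H413
open Summit.HodgeConjecture.HodgeConjecture.Cruxes.H413.K2E1ArchWhittakerContinuationU3 (integral_integral_archSymbolU3_mul_phase_eq)

namespace Summit.HodgeConjecture.HodgeConjecture.Cruxes.H413.K2E1AdelicFourierCoeffEulerProductCM

/-! ## §1 The archimedean part over a totally complex field is the product of the one-variable transforms on `ℂ` -/

section TotallyComplex

variable (K : Type) [Field K] [NumberField K]

/-- `𝐞(−Σ_i 2 Re(a_i X_i)) = ∏_i e^{−4πi·Re(a_i X_i)}` in `ℂ` (Mathlib `Real.fourierChar_apply`, `Complex.exp_sum`) — the link between Tate's kernel at the complex places (`mixedTrace = 2 Re`) and the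
one-variable kernel `e^{−4πi Re(ξX)}` of ★ p858580. [folklore] -/
theorem coe_fourierChar_neg_sum_two_mul_re {ι : Type*} [Fintype ι] (a X : ι → ℂ) :
    (𝐞 (-(∑ i, 2 * (a i * X i).re)) : ℂ) = ∏ i, Complex.exp (-(4 * π * Complex.I * (a i * X i).re)) := by
  rw [Real.fourierChar_apply, ← Complex.exp_sum]
  congr 1
  push_cast
  rw [mul_neg, Finset.mul_sum, neg_mul, Finset.sum_mul, ← Finset.sum_neg_distrib]
  exact Finset.sum_congr rfl fun i _ => by ring

/-- Over a TOTALLY COMPLEX `K` the trace form is twice the sum of the real parts of the complex coordinates: `Tr(ξ·s) = Σ_w 2 Re(ξ_w·s_w)` (no real places; `ξ_w = (mixedEmbedding K ξ).2 w`).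
[folklore] -/
theorem mixedTrace_mixedEmbedding_mul_of_isTotallyComplex [IsTotallyComplex K] (ξ : K) (s : mixedSpace K) :
    mixedTrace K (mixedEmbedding K ξ * s) = ∑ w : {w : InfinitePlace K // IsComplex w}, 2 * ((mixedEmbedding K ξ).2 w * s.2 w).re := by
  haveI : IsEmpty {w : InfinitePlace K // IsReal w} := ⟨fun w => (not_isComplex_iff_isReal.2 w.2) (IsTotallyComplex.isComplex w.1)⟩
  simp only [mixedTrace_apply, Finset.univ_eq_empty, Finset.sum_empty, zero_add]
  rfl

/-- **THE ARCHIMEDEAN WHITTAKER FACTOR SPLITS OVER THE COMPLEX PLACES** (`K` totally complex, Lebesgue measure on `mixedSpace K = (∅ → ℝ) × (w → ℂ)`): for any `φ_w : ℂ → ℂ`,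
`∫ (∏_w φ_w(s_w))·𝐞(−Tr(ξs)) ds = ∏_w ∫_ℂ φ_w(X)·e^{−4πi Re(ξ_w X)} dX`, `ξ_w = (mixedEmbedding K ξ)_w` — each factor is the kernel of ★ p858580 (Mathlib `integral_fun_snd` to discard the trivial
real factor, `integral_fintype_prod_volume_eq_prod`).  The complex twin of ★ W3-engine `integral_prod_mul_fourierChar_eq_prod` :242. [cite: TateThesis1967, §4.1] [cite: Bump1997, §1.6 (1.26)] -/
theorem integral_prod_mul_fourierChar_eq_prod_of_isTotallyComplex [IsTotallyComplex K] (φ : {w : InfinitePlace K // IsComplex w} → ℂ → ℂ) (ξ : K) :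
    ∫ s : mixedSpace K, (∏ w, φ w (s.2 w)) * (𝐞 (-(mixedTrace K (mixedEmbedding K ξ * s))) : ℂ) =
      ∏ w : {w : InfinitePlace K // IsComplex w}, ∫ X : ℂ, φ w X * Complex.exp (-(4 * π * Complex.I * ((mixedEmbedding K ξ).2 w * X).re)) := by
  haveI : IsEmpty {w : InfinitePlace K // IsReal w} := ⟨fun w => (not_isComplex_iff_isReal.2 w.2) (IsTotallyComplex.isComplex w.1)⟩
  -- the integrand is a function of the complex coordinates alone, a product over the complex places
  have hF : (fun s : mixedSpace K => (∏ w, φ w (s.2 w)) * (𝐞 (-(mixedTrace K (mixedEmbedding K ξ * s))) : ℂ)) =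
      fun s => (fun X : {w : InfinitePlace K // IsComplex w} → ℂ =>
        ∏ w, φ w (X w) * Complex.exp (-(4 * π * Complex.I * ((mixedEmbedding K ξ).2 w * X w).re))) s.2 := by
    funext s
    dsimp only
    rw [mixedTrace_mixedEmbedding_mul_of_isTotallyComplex, coe_fourierChar_neg_sum_two_mul_re, Finset.prod_mul_distrib]
  have h1 : (volume : Measure ({w : InfinitePlace K // IsReal w} → ℝ)).real univ = 1 := by
    rw [measureReal_def, volume_pi, Measure.pi_univ, Finset.prod_of_isEmpty, ENNReal.toReal_one]
  have key := integral_fun_snd (μ := (volume : Measure ({w : InfinitePlace K // IsReal w} → ℝ))) (ν := (volume : Measure ({w : InfinitePlace K // IsComplex w} → ℂ)))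
    (fun X : {w : InfinitePlace K // IsComplex w} → ℂ => ∏ w, φ w (X w) * Complex.exp (-(4 * π * Complex.I * ((mixedEmbedding K ξ).2 w * X w).re)))
  have key2 := integral_fintype_prod_volume_eq_prod (𝕜 := ℂ)
    (fun (w : {w : InfinitePlace K // IsComplex w}) (Y : ℂ) => φ w Y * Complex.exp (-(4 * π * Complex.I * ((mixedEmbedding K ξ).2 w * Y).re)))
  rw [h1, one_smul] at key
  rw [hF, volume_eq_prod]
  exact key.trans key2

/-- The same with the complex places RE-INDEXED along any bijection `e : ι ≃ {w ∣ ∞ complex}`: `∫ (∏_i φ_i(s_{e i}))·𝐞(−Tr(ξs)) ds = ∏_i ∫_ℂ φ_i(X)·e^{−4πi Re(ξ_{e i} X)} dX`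
(twin of ★ :264). [cite: TateThesis1967, §4.1] [cite: Bump1997, §1.6 (1.26)] -/
theorem integral_prod_mul_fourierChar_eq_prod_of_isTotallyComplex_of_equiv [IsTotallyComplex K] {ι : Type*} [Fintype ι] (e : ι ≃ {w : InfinitePlace K // IsComplex w})
    (φ : ι → ℂ → ℂ) (ξ : K) :
    ∫ s : mixedSpace K, (∏ i, φ i (s.2 (e i))) * (𝐞 (-(mixedTrace K (mixedEmbedding K ξ * s))) : ℂ) =
      ∏ i, ∫ X : ℂ, φ i X * Complex.exp (-(4 * π * Complex.I * ((mixedEmbedding K ξ).2 (e i) * X).re)) := by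
  have h := integral_prod_mul_fourierChar_eq_prod_of_isTotallyComplex K (fun w => φ (e.symm w)) ξ
  have hre : ∀ s : mixedSpace K, (∏ w, φ (e.symm w) (s.2 w)) = ∏ i, φ i (s.2 (e i)) := fun s =>
    (Fintype.prod_equiv e _ _ fun i => by rw [Equiv.symm_apply_apply]).symm
  simp_rw [hre] at h
  rw [h]
  exact (Fintype.prod_equiv e _ _ fun i => by rw [Equiv.symm_apply_apply]).symm

/-- **Indexed by ALL infinite places** (all complex; `s_w := s.2 ⟨w, _⟩`, `ξ_w = w.embedding ξ` by Mathlib `mixedEmbedding_apply_isComplex`):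
`∫ (∏_w φ_w(s_w))·𝐞(−Tr(ξs)) ds = ∏_{w : InfinitePlace K} ∫_ℂ φ_w(X)·e^{−4πi Re(w.embedding ξ · X)} dX` — the natural index of the CM symbol ★ (a2)₃ :325. [cite: TateThesis1967, §4.1]
[cite: Bump1997, §1.6 (1.26)] -/
theorem integral_prod_mul_fourierChar_eq_prod_infinitePlace [IsTotallyComplex K] (φ : InfinitePlace K → ℂ → ℂ) (ξ : K) :
    ∫ s : mixedSpace K, (∏ w : InfinitePlace K, φ w (s.2 ⟨w, IsTotallyComplex.isComplex w⟩)) * (𝐞 (-(mixedTrace K (mixedEmbedding K ξ * s))) : ℂ) =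
      ∏ w : InfinitePlace K, ∫ X : ℂ, φ w X * Complex.exp (-(4 * π * Complex.I * (w.embedding ξ * X).re)) := by
  have h := integral_prod_mul_fourierChar_eq_prod_of_isTotallyComplex_of_equiv K
    (Equiv.subtypeUnivEquiv (fun w : InfinitePlace K => IsTotallyComplex.isComplex w)).symm φ ξ
  have hemb : ∀ w : InfinitePlace K,
      (mixedEmbedding K ξ).2 ((Equiv.subtypeUnivEquiv (fun w : InfinitePlace K => IsTotallyComplex.isComplex w)).symm w) = w.embedding ξ := fun w => by
    rw [mixedEmbedding_apply_isComplex]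
    rfl
  simp_rw [hemb] at h
  exact h

/-- **THE ADELIC FOURIER COEFFICIENT OF A PURE TENSOR OVER A TOTALLY COMPLEX FIELD** (★ W3-engine §1 `adeleFourierCoeff_map_split_eq_mul` at `μ_E := volume`, `Φ_∞ = ∏_w φ_w`):
for `μ := σ_*(vol ⊗ μ_f)` on `𝔸_K`, `Φ(x) = (∏_w φ_w((ι x_∞)_w))·Φ_f(x_f)`,
`Φ̂(ξ) = (∏_w ∫_ℂ φ_w(X)·e^{−4πi Re(ξ_w X)} dX) · ∫ Φ_f(b)·ψ_f(ξb) dμ_f(b)` — the `Λ = A·I` shape with `A` an honest product over the complex places. [cite: TateThesis1967, §4.1]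
[cite: Garrett2018, §1.9] -/
theorem adeleFourierCoeff_map_split_eq_prod_mul_of_isTotallyComplex [IsTotallyComplex K] [MeasurableSpace (AdeleRing (𝓞 K) K)] [BorelSpace (AdeleRing (𝓞 K) K)]
    [MeasurableSpace (FiniteAdeleRing (𝓞 K) K)] [BorelSpace (FiniteAdeleRing (𝓞 K) K)] (μf : Measure (FiniteAdeleRing (𝓞 K) K)) [SFinite μf]
    {σ : mixedSpace K × FiniteAdeleRing (𝓞 K) K → AdeleRing (𝓞 K) K} (hσ : ∀ p, (σ p).1 = (InfiniteAdeleRing.ringEquiv_mixedSpace K).symm p.1 ∧ (σ p).2 = p.2)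
    (φ : {w : InfinitePlace K // IsComplex w} → ℂ → ℂ) (Φfin : FiniteAdeleRing (𝓞 K) K → ℂ) (ξ : K) :
    adeleFourierCoeff (((volume : Measure (mixedSpace K)).prod μf).map σ)
        (fun x => (∏ w, φ w ((InfiniteAdeleRing.ringEquiv_mixedSpace K x.1).2 w)) * Φfin x.2) ξ =
      (∏ w : {w : InfinitePlace K // IsComplex w}, ∫ X : ℂ, φ w X * Complex.exp (-(4 * π * Complex.I * ((mixedEmbedding K ξ).2 w * X).re))) *
        ∫ b, Φfin b * (finiteAdeleAddChar K (algebraMap K (FiniteAdeleRing (𝓞 K) K) ξ * b) : ℂ) ∂μf := by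
  have h := K2E1AdelicFourierCoeffEulerProduct.adeleFourierCoeff_map_split_eq_mul K volume μf hσ (fun s => ∏ w, φ w (s.2 w)) Φfin ξ
  rw [integral_prod_mul_fourierChar_eq_prod_of_isTotallyComplex] at h
  exact h

/-- `volume(D_∞) = 2^{−[K:ℚ]∕2}·√|d_K|` for a TOTALLY COMPLEX `K` (Mathlib `volume_fundamentalDomain_latticeBasis` with `[K:ℚ] = 2·r₂`). [cite: TateThesis1967, §4.1 Lemma 4.1.4] -/
theorem volume_fundamentalDomain_latticeBasis_of_isTotallyComplex [IsTotallyComplex K] :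
    volume (ZSpan.fundamentalDomain (latticeBasis K)) = (2 : ℝ≥0∞)⁻¹ ^ (Module.finrank ℚ K / 2) * ENNReal.ofNNReal (NNReal.sqrt ‖discr K‖₊) := by
  rw [volume_fundamentalDomain_latticeBasis, IsTotallyComplex.finrank, Nat.mul_div_cancel_left _ two_pos]

end TotallyComplex

/-! ## §2 The CM frame: `r₂(L) = [L⁺ : ℚ] = d` and the ONE evaluation of the `μ_E(D_E)` letter -/

section CM

variable (L : Type) [Field L] [NumberField L] [IsCMField L]

/-- For a CM field `L` the number of complex places is the degree of the maximal real subfield: `r₂(L) = [L⁺ : ℚ]` (`[L:ℚ] = 2r₂ = 2[L⁺:ℚ]`; Mathlib `IsTotallyComplex.finrank`,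
`Algebra.IsQuadraticExtension.finrank_eq_two`, `Module.finrank_mul_finrank`). [folklore] -/
theorem nrComplexPlaces_eq_finrank_maximalRealSubfield : nrComplexPlaces L = Module.finrank ℚ (maximalRealSubfield L) := by
  have h1 := IsTotallyComplex.finrank (K := L)
  have h2 : Module.finrank ℚ L = Module.finrank ℚ (maximalRealSubfield L) * 2 := by
    rw [← Module.finrank_mul_finrank ℚ (maximalRealSubfield L) L, Algebra.IsQuadraticExtension.finrank_eq_two (maximalRealSubfield L) L]
  omega

/-- **`volume(D_∞(L)) = 2^{−d}·√|d_L|`, `d = [L⁺ : ℚ]`**, for a CM field `L` — the archimedean constant of CONVENTIONS W0₃ §1 (W) (`r₂(E) = d`). [cite: TateThesis1967, §4.1 Lemma 4.1.4] -/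
theorem volume_fundamentalDomain_latticeBasis_cm :
    volume (ZSpan.fundamentalDomain (latticeBasis L)) = (2 : ℝ≥0∞)⁻¹ ^ Module.finrank ℚ (maximalRealSubfield L) * ENNReal.ofNNReal (NNReal.sqrt ‖discr L‖₊) := by
  rw [volume_fundamentalDomain_latticeBasis, nrComplexPlaces_eq_finrank_maximalRealSubfield]

/-- **THE ONE EVALUATION OF THE `μ_E(D_E)` LETTER** (RULING «LETTERS-μD»; heads elsewhere keep `μ_E(D_E)⁻¹` unexpanded): for the split measure `μ = σ_*(vol ⊗ μ_f)` on `𝔸_L`,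
`μ(D_L) = 2^{−d}·√|d_L|·μ_f(𝒪̂_L)` (★ W3-engine `measure_map_split_adeleFundamentalDomain` at `μ_E := volume`, then §2). [cite: TateThesis1967, §4.1 Thm 4.1.3] -/
theorem measure_map_split_adeleFundamentalDomain_cm [MeasurableSpace (AdeleRing (𝓞 L) L)] [BorelSpace (AdeleRing (𝓞 L) L)] [MeasurableSpace (FiniteAdeleRing (𝓞 L) L)]
    [BorelSpace (FiniteAdeleRing (𝓞 L) L)] (μf : Measure (FiniteAdeleRing (𝓞 L) L)) [SFinite μf]
    {σ : mixedSpace L × FiniteAdeleRing (𝓞 L) L → AdeleRing (𝓞 L) L} (hσ : ∀ p, (σ p).1 = (InfiniteAdeleRing.ringEquiv_mixedSpace L).symm p.1 ∧ (σ p).2 = p.2) :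
    (((volume : Measure (mixedSpace L)).prod μf).map σ) (adeleFundamentalDomain L) =
      (2 : ℝ≥0∞)⁻¹ ^ Module.finrank ℚ (maximalRealSubfield L) * ENNReal.ofNNReal (NNReal.sqrt ‖discr L‖₊) * μf {b : FiniteAdeleRing (𝓞 L) L | ∀ v, b v ∈ v.adicCompletionIntegers L} := by
  rw [K2E1AdelicFourierCoeffEulerProduct.measure_map_split_adeleFundamentalDomain L volume μf hσ, volume_fundamentalDomain_latticeBasis_cm]

end CM

/-! ## §3 Rider: the Whittaker layer's archimedean factor `W_∞(ξ,z)` at `g = k` in closed form (D-W2 letters) -/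

section Arch

variable (K : Type) [Field K] [NumberField K]

/-- **`W_∞(ξ,z)` IN CLOSED FORM** (`K` totally complex — every CM field; `|δ|_w = dδ_w > 0`; `Re z > 1`): with the centre-averaged big-cell symbol
`φ_w(X) := ∫_ℝ ((1 + ½|X|²)² + |δ|_w² t²)^{−z} dt` at each (complex) place `w`,
`∫_{mixedSpace K} (∏_w φ_w(s_w))·𝐞(−Tr(ξs)) ds = ∏_w 2π²·4^{1−z}·|δ|_w⁻¹·Γ(z)⁻²·𝓜[t ↦ e^{−t − 8π²|w.embedding ξ|²∕t}](2z − 2)` (§1 indexed by all places, then ★ p858580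
`integral_integral_archSymbolU3_mul_phase_eq` at `ξ_w = w.embedding ξ`, place by place). [cite: Bump1997, §1.6 (1.26)–(1.27), §3.7] [cite: Garrett2018, §1.10] -/
theorem integral_prod_archCentre_mul_fourierChar_eq_prod [IsTotallyComplex K] (dδ : InfinitePlace K → ℝ) (hδ : ∀ w, 0 < dδ w) (ξ : K) {z : ℂ} (hz : 1 < z.re) :
    ∫ s : mixedSpace K, (∏ w : InfinitePlace K,
        ∫ t : ℝ, ((((1 + ‖s.2 ⟨w, IsTotallyComplex.isComplex w⟩‖ ^ 2 / 2) ^ 2 + dδ w ^ 2 * t ^ 2 : ℝ)) : ℂ) ^ (-z)) *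
        (𝐞 (-(mixedTrace K (mixedEmbedding K ξ * s))) : ℂ) =
      ∏ w : InfinitePlace K, 2 * (π : ℂ) ^ 2 * (4 : ℂ) ^ (1 - z) * ((dδ w : ℝ) : ℂ)⁻¹ * (Complex.Gamma z)⁻¹ ^ 2 *
        mellin (fun t : ℝ => Complex.exp (-(t : ℂ) - ((8 * π ^ 2 * ‖w.embedding ξ‖ ^ 2 : ℝ) : ℂ) / (t : ℂ))) (2 * z - 2) := by
  rw [integral_prod_mul_fourierChar_eq_prod_infinitePlace K
    (fun w X => ∫ t : ℝ, ((((1 + ‖X‖ ^ 2 / 2) ^ 2 + dδ w ^ 2 * t ^ 2 : ℝ)) : ℂ) ^ (-z)) ξ]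
  exact Finset.prod_congr rfl fun w _ => integral_integral_archSymbolU3_mul_phase_eq (hδ w) (w.embedding ξ) hz

end Arch

end Summit.HodgeConjecture.HodgeConjecture.Cruxes.H413.K2E1AdelicFourierCoeffEulerProductCM

end
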